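import Literature.NumberTheory.Automorphic.ACCAutomorphyLiftingCrystalline
import HarnessLib

/-!
# Route `RamifiedCoefficientSeed`, crux `AdjointLiftingGL3` (stmt-Langlands-16779): vocabulary of the
# line `birth`

Route-posited statements (D-0016 `<Route>Defs`-type file) shared by the registered stubs of the
checked skeleton `Cruxes/AdjointLiftingGL3/Lines/birth.lean` (skeleton v3, line lead
prover-line-stmt-Langlands-16779-0, 2026-08-17) and by the composition `AdjointLiftingGL3_of` of that
skeleton.  NOTHING IS ASSERTED here: every `def … : Prop` below is a *statement*, consumed only as
(part of) the type of a stub theorem; each is a clause of the crux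
`Summit.Langlands.Langlands.Theses.RamifiedCoefficientSeed.AdjointLiftingGL3` written out VERBATIM (or
a conjunct of a registered stub), so that the crux's hypotheses feed the stubs by `Iff.rfl`, and so
that stub signatures are SHORT and contain no `let … :=` (the stub registry splits a signature at its
first `:=`, which truncated the v1/v2 registrations of the two stubs carrying the crystalline clause).
Declared in the skeleton's namespace `Summit.Langlands.Langlands.Cruxes.AdjointLiftingGL3.Birth`, so
that a landed `theorem stub_<name> : <registered signature>` reads byte-identically to its
registration.  This module does NOT import the route module (the closing theorem's import cone must
stay free of it: the gate links `AdjointLiftingGL3_holds` INTO the route file).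

Objects (all `Prop`-valued, parameters explicit):
* `CrysHT012 p ρ` — `ρ : Γ_ℚ → GL₃(ℚ̄_p)` is crystalline at every `v ∣ p` for Fontaine's PINNED datum
  `fontainePstAdicCompletion v p hv` with labelled Hodge–Tate weights `{0,1,2}` at every
  `ℚ_p`-embedding of `ℚ_v` (the crux's second hypothesis, verbatim; `crysHT012_iff` is `Iff.rfl`);
* `AdjointSeed p ρ ρ₀ η` — the seed congruence `tr ρ ≡ η · (tr(ρ₀)²/det ρ₀ − 1) (mod 𝔪)` for ALL
  `σ ∈ Γ_ℚ`, typed as `‖·‖ < 1` in `ℚ̄_p` (the crux's fourth hypothesis minus oddness, verbatim);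
* `ScalarOffCyclotomic p τ` — `τ σ` is scalar for some `σ ∈ Γ_ℚ ∖ Γ_{ℚ(ζ_p)}` (hypothesis (4) of
  ACC+ Thm. 6.1.1, verbatim the last conjunct of stubs A/B of the skeleton);
* `TraceCongruent p ρ r` — `tr ρ ≡ tr r (mod 𝔪)` for all `σ` (the form in which the landed
  `FramedGaloisRep.IsResidualRepOf.of_trace_congr` consumes a congruence: rank `3`, `p ≥ 5`, every
  residual representation of `ρ` is one of `r`);
* `WeightZeroSeedFor p ρ ι hcpt` — the conclusion of the same-weight stub in its v3 form: a cuspidal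
  `π₀` on `GL₃(𝔸_ℚ)` of WEIGHT ZERO, unramified at `p`, and a framed `r` with HLTT's characterising
  property of `r_ι(π₀)` (`HLTT.IsCompatible`) and `TraceCongruent p ρ r` (so `ρ̄ ≅ r̄_ι(π₀)` for every
  choice of `ρ̄`).

Proved here: the `Iff.rfl` unfoldings, and the one genuine (tiny) lemma the composition needs,
`traceCongruent_of_adjointSeed` — two representations congruent to the same adjoint expression are
congruent to each other (the norm of `ℚ̄_p` is non-archimedean, Mathlib
`PadicAlgCl.isUltrametricDist`).

References: ACCGHLNSTT2023 Thm. 6.1.1, Def. 6.2.28 (the engine and its hypotheses);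
HarrisLanTaylorThorneRMS2016 Thm. A (`HLTT.IsCompatible`); DarmonDiamondTaylor1995 §2.1 (residual
representations by trace congruence).
-/

set_option linter.dupNamespace false -- `Summit.Langlands.Langlands` is the mandated namespace

noncomputable section

namespace Summit.Langlands.Langlands.Cruxes.AdjointLiftingGL3.Birth

open scoped MatrixGroups NumberField
open NumberField IsDedekindDomain Field Filter
open Literature.NumberTheory.GaloisRepresentations Literature.NumberTheory.PAdicHodge
open Literature.NumberTheory.Automorphic

/-! ## The crux's clauses, verbatim -/

/-- **Crystalline at `p` with labelled Hodge–Tate weights `{0,1,2}`** (the crux's hypothesis,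
verbatim): at every place `v ∣ p` of `ℚ`, `ρ|_{Γ_{ℚ_v}}` is crystalline for Fontaine's pinned datum
`D = fontainePstAdicCompletion v p hv` and, for the datum's `ℚ_p`-structure, every `ℚ_p`-embedding
`τ : ℚ_v → ℚ̄_p` has `HT_τ(ρ) = {0,1,2}` (convention `HT(ε) = {-1}`).
[cite: ACCGHLNSTT2023, Thm. 6.1.1 (2) and (5b), weight λ = 0, n = 3] -/
def CrysHT012 (p : ℕ) [Fact p.Prime] (ρ : FramedGaloisRep ℚ (PadicAlgCl p) 3) : Prop :=
  ∀ (v : HeightOneSpectrum (𝓞 ℚ)) (hv : ((p : ℕ) : 𝓞 ℚ) ∈ v.asIdeal),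
    let D := fontainePstAdicCompletion v p hv
    D.IsCrystallineFramed (ρ.toLocal v) ∧
      (letI := D.algebra
       ∀ τ : v.adicCompletion ℚ →ₐ[ℚ_[p]] PadicAlgCl p,
         ρ.labelledHodgeTateWeightsAt v D.algebra D.𝔅 τ.toRingHom = {0, 1, 2})

/-- Unfolding `CrysHT012` (definitional). [folklore] -/
theorem crysHT012_iff (p : ℕ) [Fact p.Prime] (ρ : FramedGaloisRep ℚ (PadicAlgCl p) 3) :
    CrysHT012 p ρ ↔
      ∀ (v : HeightOneSpectrum (𝓞 ℚ)) (hv : ((p : ℕ) : 𝓞 ℚ) ∈ v.asIdeal),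
        let D := fontainePstAdicCompletion v p hv
        D.IsCrystallineFramed (ρ.toLocal v) ∧
          (letI := D.algebra
           ∀ τ : v.adicCompletion ℚ →ₐ[ℚ_[p]] PadicAlgCl p,
             ρ.labelledHodgeTateWeightsAt v D.algebra D.𝔅 τ.toRingHom = {0, 1, 2}) :=
  Iff.rfl

/-- **The adjoint seed congruence** (the crux's hypothesis, verbatim, without oddness):
`tr ρ(σ) ≡ η(σ) · (tr ρ₀(σ)² / det ρ₀(σ) − 1) (mod 𝔪_{ℤ̄_p})` for every `σ ∈ Γ_ℚ`, i.e.
`ρ̄ ≅ η̄ ⊗ ad⁰(ρ̄₀)` on semisimplified reductions (`tr ad⁰ = tr²/det − 1`); `‖·‖ < 1` on `ℚ̄_p` is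
"`∈ 𝔪`". [cite: ACCGHLNSTT2023, Thm. 6.1.1 (5b) ("ρ̄ ≅ r̄_ι(π)")] -/
def AdjointSeed (p : ℕ) [Fact p.Prime] (ρ : FramedGaloisRep ℚ (PadicAlgCl p) 3)
    (ρ₀ : FramedGaloisRep ℚ (PadicAlgCl p) 2) (η : FramedGaloisRep ℚ (PadicAlgCl p) 1) : Prop :=
  ∀ σ, ‖(ρ σ).val.trace - (η σ).val 0 0 * ((ρ₀ σ).val.trace ^ 2 * ((ρ₀ σ).val.det)⁻¹ - 1)‖ < 1

/-- Unfolding `AdjointSeed` (definitional). [folklore] -/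
theorem adjointSeed_iff (p : ℕ) [Fact p.Prime] (ρ : FramedGaloisRep ℚ (PadicAlgCl p) 3)
    (ρ₀ : FramedGaloisRep ℚ (PadicAlgCl p) 2) (η : FramedGaloisRep ℚ (PadicAlgCl p) 1) :
    AdjointSeed p ρ ρ₀ η ↔
      ∀ σ, ‖(ρ σ).val.trace - (η σ).val 0 0 *
        ((ρ₀ σ).val.trace ^ 2 * ((ρ₀ σ).val.det)⁻¹ - 1)‖ < 1 :=
  Iff.rfl

/-- **A scalar element off `Γ_{ℚ(ζ_p)}`** (hypothesis (4) of ACC+ Thm. 6.1.1, verbatim as typed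
in the vendored fact): some `σ ∈ Γ_ℚ ∖ Γ_{ℚ(ζ_p)}` has `τ σ = c · 1`.
[cite: ACCGHLNSTT2023, Thm. 6.1.1 (4)] -/
def ScalarOffCyclotomic (p : ℕ) [Fact p.Prime]
    (τ : absoluteGaloisGroup ℚ →* GL (Fin 3) (padicAlgClResidueField p)) : Prop :=
  ∃ σ : absoluteGaloisGroup ℚ, σ ∉ absGaloisGroupAdjoinRootsOfUnity ℚ p ∧
    ∃ c : padicAlgClResidueField p,
      ((τ σ : GL (Fin 3) (padicAlgClResidueField p)) :
        Matrix (Fin 3) (Fin 3) (padicAlgClResidueField p)) = c • (1 : Matrix _ _ _)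

/-- Unfolding `ScalarOffCyclotomic` (definitional). [folklore] -/
theorem scalarOffCyclotomic_iff (p : ℕ) [Fact p.Prime]
    (τ : absoluteGaloisGroup ℚ →* GL (Fin 3) (padicAlgClResidueField p)) :
    ScalarOffCyclotomic p τ ↔
      ∃ σ : absoluteGaloisGroup ℚ, σ ∉ absGaloisGroupAdjoinRootsOfUnity ℚ p ∧
        ∃ c : padicAlgClResidueField p,
          ((τ σ : GL (Fin 3) (padicAlgClResidueField p)) :
            Matrix (Fin 3) (Fin 3) (padicAlgClResidueField p)) = c • (1 : Matrix _ _ _) :=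
  Iff.rfl

/-! ## Trace congruence and the weight-zero seed -/

/-- **`ρ` and `r` are congruent on traces**: `‖tr ρ(σ) − tr r(σ)‖ < 1` for every `σ ∈ Γ_ℚ`
(i.e. `tr ρ ≡ tr r (mod 𝔪_{ℤ̄_p})`) — the hypothesis of the accepted
`FramedGaloisRep.IsResidualRepOf.of_trace_congr` (rank `3`, `p ≥ 5`: every residual representation
of `ρ` is then one of `r`). [cite: DarmonDiamondTaylor1995, §2.1, p. 54 and Prop. 2.6 (b)] -/
def TraceCongruent (p : ℕ) [Fact p.Prime] (ρ r : FramedGaloisRep ℚ (PadicAlgCl p) 3) : Prop :=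
  ∀ σ, ‖(ρ σ).val.trace - (r σ).val.trace‖ < 1

/-- Unfolding `TraceCongruent` (definitional). [folklore] -/
theorem traceCongruent_iff (p : ℕ) [Fact p.Prime] (ρ r : FramedGaloisRep ℚ (PadicAlgCl p) 3) :
    TraceCongruent p ρ r ↔ ∀ σ, ‖(ρ σ).val.trace - (r σ).val.trace‖ < 1 :=
  Iff.rfl

/-- **A weight-zero automorphic seed for `ρ`** (the conclusion of the same-weight stub of the line,
v3 form; hypothesis (5) of ACC+ Thm. 6.1.1 at `λ = 0`): a cuspidal automorphic representation `π₀`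
of `GL₃(𝔸_ℚ)` of WEIGHT ZERO, UNRAMIFIED AT `p`, and a framed `r : Γ_ℚ → GL₃(ℚ̄_p)` with
Harris–Lan–Taylor–Thorne's characterising property of `r_ι(π₀)` (`HLTT.IsCompatible π₀.1 ι r`) which
is congruent to `ρ` on traces — so that every residual representation `τ` of `ρ` is one of `r`
("`ρ̄ ≅ r̄_ι(π₀)`"). [cite: ACCGHLNSTT2023, Thm. 6.1.1 (5)]
[cite: HarrisLanTaylorThorneRMS2016, Thm. A] -/
def WeightZeroSeedFor (p : ℕ) [Fact p.Prime] (ρ : FramedGaloisRep ℚ (PadicAlgCl p) 3)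
    (ι : PadicAlgCl p ≃+* ℂ) (hcpt : isCompact_glFiniteIntegralLevel 3 ℚ) : Prop :=
  ∃ (π₀ : CuspidalAutomorphicRepData 3 ℚ hcpt) (r : FramedGaloisRep ℚ (PadicAlgCl p) 3),
    π₀.1.HasWeightZero ∧
      (∀ v : HeightOneSpectrum (𝓞 ℚ), ((p : ℕ) : 𝓞 ℚ) ∈ v.asIdeal → π₀.1.IsUnramifiedAt v) ∧
      HLTT.IsCompatible π₀.1 ι r ∧ TraceCongruent p ρ r

/-- Unfolding `WeightZeroSeedFor` (definitional). [folklore] -/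
theorem weightZeroSeedFor_iff (p : ℕ) [Fact p.Prime] (ρ : FramedGaloisRep ℚ (PadicAlgCl p) 3)
    (ι : PadicAlgCl p ≃+* ℂ) (hcpt : isCompact_glFiniteIntegralLevel 3 ℚ) :
    WeightZeroSeedFor p ρ ι hcpt ↔
      ∃ (π₀ : CuspidalAutomorphicRepData 3 ℚ hcpt) (r : FramedGaloisRep ℚ (PadicAlgCl p) 3),
        π₀.1.HasWeightZero ∧
          (∀ v : HeightOneSpectrum (𝓞 ℚ), ((p : ℕ) : 𝓞 ℚ) ∈ v.asIdeal → π₀.1.IsUnramifiedAt v) ∧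
          HLTT.IsCompatible π₀.1 ι r ∧ TraceCongruent p ρ r :=
  Iff.rfl

/-- `TraceCongruent` is symmetric. [folklore] -/
theorem TraceCongruent.symm {p : ℕ} [Fact p.Prime] {ρ r : FramedGaloisRep ℚ (PadicAlgCl p) 3}
    (h : TraceCongruent p ρ r) : TraceCongruent p r ρ := fun σ => by
  rw [← norm_neg, neg_sub]; exact h σ

/-- `TraceCongruent` is transitive (the norm of `ℚ̄_p` is non-archimedean,
`PadicAlgCl.isUltrametricDist`). [folklore] -/
theorem TraceCongruent.trans {p : ℕ} [Fact p.Prime] {ρ r s : FramedGaloisRep ℚ (PadicAlgCl p) 3}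
    (h₁ : TraceCongruent p ρ r) (h₂ : TraceCongruent p r s) : TraceCongruent p ρ s := fun σ => by
  have hdist : dist (ρ σ).val.trace (s σ).val.trace ≤
      max (dist (ρ σ).val.trace (r σ).val.trace) (dist (r σ).val.trace (s σ).val.trace) :=
    dist_triangle_max _ _ _
  simp only [dist_eq_norm] at hdist
  exact lt_of_le_of_lt hdist (max_lt (h₁ σ) (h₂ σ))

/-- **Two representations congruent to the same adjoint expression are congruent to each other**:
if `tr ρ ≡ η (tr ρ₀²/det ρ₀ − 1)` and `tr r ≡ η (tr ρ₀²/det ρ₀ − 1) (mod 𝔪)` then `tr ρ ≡ tr r`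
(ultrametric inequality in `ℚ̄_p`).  This is how the same-weight stub's output (`r` congruent to
the seed's adjoint expression) is turned into `TraceCongruent p ρ r`. [folklore] -/
theorem traceCongruent_of_adjointSeed :
    ∀ {p : ℕ} [Fact p.Prime] {ρ r : FramedGaloisRep ℚ (PadicAlgCl p) 3}
      {ρ₀ : FramedGaloisRep ℚ (PadicAlgCl p) 2} {η : FramedGaloisRep ℚ (PadicAlgCl p) 1},
      AdjointSeed p ρ ρ₀ η → AdjointSeed p r ρ₀ η → TraceCongruent p ρ r := by
  intro p _ ρ r ρ₀ η hρ hr σ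
  set a := (η σ).val 0 0 * ((ρ₀ σ).val.trace ^ 2 * ((ρ₀ σ).val.det)⁻¹ - 1) with ha
  have hdist : dist (ρ σ).val.trace (r σ).val.trace ≤
      max (dist (ρ σ).val.trace a) (dist a (r σ).val.trace) := dist_triangle_max _ _ _
  simp only [dist_eq_norm] at hdist
  refine lt_of_le_of_lt hdist (max_lt (hρ σ) ?_)
  rw [← norm_neg, neg_sub]
  exact hr σ

end Summit.Langlands.Langlands.Cruxes.AdjointLiftingGL3.Birth

end
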